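import Summits.Ventures.HodgeRepro2.T5IntertwinerDimension

/-!
# `dim Hom_G(π, π') = ∫ χ_π' · conj χ_π`, and the irreducibility criterion `∫ |χ_π|² = 1`

For continuous finite-dimensional representations `π`, `π'` of a compact Hausdorff group `G` the
space of intertwining maps `Hom_G(π, π')` (Mathlib's `Representation.IntertwiningMap`) has dimension
`∫ χ_π' · conj χ_π` (`finrank_intertwiningMap_eq_integral'`).  Consequences:
`dim Hom_G(π, π') = dim Hom_G(π', π)`, `dim End_G(π) = ∫ |χ_π|²`, and the **irreducibility
criterion**: a non-zero continuous finite-dimensional `π` is irreducible iff `∫ |χ_π|² = 1`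
(`isIrreducible_iff_integral_norm_sq_eq_one`).

Method: the source-side splitting `Hom_G(ρ₁ × ρ₂, σ) ≃ₗ Hom_G(ρ₁, σ) × Hom_G(ρ₂, σ)`
(`homProdEquivLeft`, built from Mathlib's `IntertwiningMap.inl / inr / fst / snd`) and strong
induction on `dim V` reduce the general formula to the irreducible-source case of
`T5IntertwinerDimension.finrank_intertwiningMap_eq_integral`; reducibility forces
`dim End_G(π) ≥ 2` through the same splitting, while Schur's lemma gives `dim End_G(π) = 1` for an
irreducible `π`.

Blind lane: Mathlib + own prefix only; no sorry; axioms ⊆ {propext, Classical.choice, Quot.sound}.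
-/

namespace Summit.Ventures.HodgeRepro2.T5IntertwinerFormula

open T5SchurOrthogonality T5CompleteReducibility T5RestrictionRep T5Multiplicity T5SchurMathlib
  T5CharacterDeterminesGeneral T5IntertwinerDimension MeasureTheory

universe u u'

section General

variable {A : Type*} [CommSemiring A] {G : Type*} [Monoid G]
  {V : Type*} [AddCommMonoid V] [Module A V] {W : Type*} [AddCommMonoid W] [Module A W]
  {U : Type*} [AddCommMonoid U] [Module A U]

/-- `inl v = (v, 0)`. -/
theorem inl_apply (ρ₁ : Representation A G V) (ρ₂ : Representation A G W) (v : V) :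
    Representation.IntertwiningMap.inl A ρ₁ ρ₂ v = (v, 0) := rfl

/-- `inr w = (0, w)`. -/
theorem inr_apply (ρ₁ : Representation A G V) (ρ₂ : Representation A G W) (w : W) :
    Representation.IntertwiningMap.inr A ρ₁ ρ₂ w = (0, w) := rfl

/-- `Hom_G(ρ₁ × ρ₂, σ) ≃ₗ Hom_G(ρ₁, σ) × Hom_G(ρ₂, σ)` (splitting on the source). -/
noncomputable def homProdEquivLeft (ρ₁ : Representation A G V) (ρ₂ : Representation A G W)
    (σ : Representation A G U) :
    (ρ₁.prod ρ₂).IntertwiningMap σ ≃ₗ[A] ρ₁.IntertwiningMap σ × ρ₂.IntertwiningMap σ where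
  toFun f := (f.comp (Representation.IntertwiningMap.inl A ρ₁ ρ₂),
    f.comp (Representation.IntertwiningMap.inr A ρ₁ ρ₂))
  invFun p := p.1.comp (Representation.IntertwiningMap.fst A ρ₁ ρ₂) +
    p.2.comp (Representation.IntertwiningMap.snd A ρ₁ ρ₂)
  map_add' f g := Prod.ext (Representation.IntertwiningMap.comp_add _ _ _ f g _)
    (Representation.IntertwiningMap.comp_add _ _ _ f g _)
  map_smul' a f := Prod.ext (Representation.IntertwiningMap.smul_comp _ _ _ a f _)
    (Representation.IntertwiningMap.smul_comp _ _ _ a f _)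
  left_inv f := by
    apply Representation.IntertwiningMap.ext
    apply LinearMap.ext
    rintro ⟨v, w⟩
    simp only [Representation.IntertwiningMap.coe_toLinearMap, Representation.IntertwiningMap.coe_add,
      Pi.add_apply, Representation.IntertwiningMap.comp_apply, inl_apply, inr_apply,
      Representation.IntertwiningMap.fst_apply, Representation.IntertwiningMap.snd_apply]
    rw [← map_add, Prod.mk_add_mk, add_zero, zero_add]
  right_inv p := by
    refine Prod.ext ?_ ?_
    · apply Representation.IntertwiningMap.ext
      apply LinearMap.ext
      intro v
      simp only [Representation.IntertwiningMap.coe_toLinearMap,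
        Representation.IntertwiningMap.comp_apply, Representation.IntertwiningMap.coe_add,
        Pi.add_apply, inl_apply, Representation.IntertwiningMap.fst_apply,
        Representation.IntertwiningMap.snd_apply, map_zero, add_zero]
    · apply Representation.IntertwiningMap.ext
      apply LinearMap.ext
      intro w
      simp only [Representation.IntertwiningMap.coe_toLinearMap,
        Representation.IntertwiningMap.comp_apply, Representation.IntertwiningMap.coe_add,
        Pi.add_apply, inr_apply, Representation.IntertwiningMap.fst_apply,
        Representation.IntertwiningMap.snd_apply, map_zero, zero_add]

/-- Composition on the source with a representation equivalence `e : ρ ≃ ρ'` is a linear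
equivalence `Hom_G(ρ', σ) ≃ₗ Hom_G(ρ, σ)`. -/
noncomputable def homEquivOfEquivLeft {ρ : Representation A G V} {ρ' : Representation A G W}
    (e : ρ.Equiv ρ') (σ : Representation A G U) :
    ρ'.IntertwiningMap σ ≃ₗ[A] ρ.IntertwiningMap σ where
  toFun f := f.comp e.toIntertwiningMap
  invFun f := f.comp e.symm.toIntertwiningMap
  map_add' f g := Representation.IntertwiningMap.comp_add _ _ _ f g _
  map_smul' a f := Representation.IntertwiningMap.smul_comp _ _ _ a f _
  left_inv f := by
    apply Representation.IntertwiningMap.ext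
    apply LinearMap.ext
    intro v
    simp only [Representation.IntertwiningMap.coe_toLinearMap,
      Representation.IntertwiningMap.comp_apply, Representation.Equiv.coe_toIntertwiningMap,
      Representation.Equiv.apply_symm_apply]
  right_inv f := by
    apply Representation.IntertwiningMap.ext
    apply LinearMap.ext
    intro v
    simp only [Representation.IntertwiningMap.coe_toLinearMap,
      Representation.IntertwiningMap.comp_apply, Representation.Equiv.coe_toIntertwiningMap,
      Representation.Equiv.symm_apply_apply]

end General

variable {G : Type*} [Group G] [TopologicalSpace G] [IsTopologicalGroup G] [MeasurableSpace G]
  [BorelSpace G] [CompactSpace G] [T2Space G]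

section Main

/-- The induction on the dimension of the source. -/
theorem finrank_intertwiningMap_eq_integral_aux' (n : ℕ) :
    ∀ {V : Type u} [NormedAddCommGroup V] [InnerProductSpace ℂ V] [FiniteDimensional ℂ V]
      {V' : Type u'} [NormedAddCommGroup V'] [InnerProductSpace ℂ V'] [FiniteDimensional ℂ V']
      (π : G →* V →L[ℂ] V) (π' : G →* V' →L[ℂ] V'), Continuous π → Continuous π' →
      Module.finrank ℂ V = n →
      (Module.finrank ℂ ((toRep π).IntertwiningMap (toRep π')) : ℂ) =
        ∫ g, character π' g * (starRingEnd ℂ) (character π g) ∂haarProb G := by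
  induction n using Nat.strong_induction_on with
  | _ n ih =>
  intro V _ _ _ V' _ _ _ π π' hπ hπ' hn
  by_cases hn0 : n = 0
  · subst hn0
    haveI : Subsingleton V := Module.finrank_zero_iff.1 hn
    haveI : Subsingleton ((toRep π).IntertwiningMap (toRep π')) :=
      ⟨fun f g => Representation.IntertwiningMap.ext (LinearMap.ext fun v => by
        rw [Subsingleton.elim v 0, map_zero, map_zero])⟩
    have hchar : ∀ g, character π g = 0 := by
      intro g
      change LinearMap.trace ℂ V (π g : V →ₗ[ℂ] V) = 0
      rw [Subsingleton.elim (π g : V →ₗ[ℂ] V) 0, map_zero]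
    simp only [Module.finrank_zero_of_subsingleton, Nat.cast_zero, hchar, map_zero, mul_zero,
      integral_zero]
  · have htop : (⊤ : Submodule ℂ V) ≠ ⊥ := by
      intro hbot
      apply hn0
      rw [← hn, ← finrank_top ℂ V, Submodule.finrank_eq_zero]
      exact hbot
    obtain ⟨W, -, hW⟩ := exists_irreducibleSubspace_le π (isStable_top π) htop
    obtain ⟨C, hC, hWC⟩ := T5AveragedProjection.exists_isCompl_isStable_of_compact π hπ hW.2.1
    haveI : Nontrivial W := nontrivial_of_isIrreducibleSubspace π W hW
    have hsplit : Module.finrank ℂ ((toRep π).IntertwiningMap (toRep π')) =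
        Module.finrank ℂ ((toRep (restrictRep π W hW.2.1)).IntertwiningMap (toRep π')) +
          Module.finrank ℂ ((toRep (restrictRep π C hC)).IntertwiningMap (toRep π')) := by
      rw [LinearEquiv.finrank_eq (homEquivOfEquivLeft (equivProdOfIsCompl π hW.2.1 hC hWC) (toRep π')),
        LinearEquiv.finrank_eq (homProdEquivLeft _ _ (toRep π')), Module.finrank_prod]
    have hlt : Module.finrank ℂ C < n := by
      have hWpos : 0 < Module.finrank ℂ W :=
        Nat.pos_of_ne_zero fun h0 => hW.1 (Submodule.finrank_eq_zero.1 h0)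
      have := Submodule.finrank_add_eq_of_isCompl hWC
      omega
    have hIH := ih _ hlt (restrictRep π C hC) π' (continuous_restrictRep π hπ C hC) hπ' rfl
    have hW1 := finrank_intertwiningMap_eq_integral (restrictRep π W hW.2.1)
      (continuous_restrictRep π hπ W _) (isIrreducible_restrictRep π W hW _) π' hπ'
    have hadd : (fun g => character π' g * (starRingEnd ℂ) (character π g)) =
        fun g => character π' g * (starRingEnd ℂ) (character (restrictRep π W hW.2.1) g) +
          character π' g * (starRingEnd ℂ) (character (restrictRep π C hC) g) := by
      funext g
      rw [character_eq_add_of_isCompl π hW.2.1 hC hWC g, map_add, mul_add]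
    rw [hsplit, Nat.cast_add, hIH, hW1, hadd, integral_add]
    · exact T5CharacterTheory.integrable_character_mul_conj (haarProb G) π' _ hπ'
        (continuous_restrictRep π hπ W _)
    · exact T5CharacterTheory.integrable_character_mul_conj (haarProb G) π' _ hπ'
        (continuous_restrictRep π hπ C hC)

variable {V : Type u} [NormedAddCommGroup V] [InnerProductSpace ℂ V] [FiniteDimensional ℂ V]
  {V' : Type u'} [NormedAddCommGroup V'] [InnerProductSpace ℂ V'] [FiniteDimensional ℂ V']

/-- **`dim Hom_G(π, π') = ∫ χ_π' · conj χ_π`** for continuous finite-dimensional representations of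
a compact Hausdorff group. -/
theorem finrank_intertwiningMap_eq_integral' (π : G →* V →L[ℂ] V) (π' : G →* V' →L[ℂ] V')
    (hπ : Continuous π) (hπ' : Continuous π') :
    (Module.finrank ℂ ((toRep π).IntertwiningMap (toRep π')) : ℂ) =
      ∫ g, character π' g * (starRingEnd ℂ) (character π g) ∂haarProb G :=
  finrank_intertwiningMap_eq_integral_aux' _ π π' hπ hπ' rfl

/-- `dim Hom_G(π, π') = dim Hom_G(π', π)`. -/
theorem finrank_intertwiningMap_comm (π : G →* V →L[ℂ] V) (π' : G →* V' →L[ℂ] V')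
    (hπ : Continuous π) (hπ' : Continuous π') :
    Module.finrank ℂ ((toRep π).IntertwiningMap (toRep π')) =
      Module.finrank ℂ ((toRep π').IntertwiningMap (toRep π)) := by
  have h1 := finrank_intertwiningMap_eq_integral' π π' hπ hπ'
  have h2 := finrank_intertwiningMap_eq_integral' π' π hπ' hπ
  have hconj : ∫ g, character π g * (starRingEnd ℂ) (character π' g) ∂haarProb G =
      (starRingEnd ℂ) (∫ g, character π' g * (starRingEnd ℂ) (character π g) ∂haarProb G) := by
    rw [← integral_conj]
    congr 1
    funext g
    rw [map_mul, Complex.conj_conj, mul_comm]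
  rw [hconj, ← h1, Complex.conj_natCast] at h2
  exact_mod_cast h2.symm

/-- `dim End_G(π) = ∫ |χ_π|²`. -/
theorem finrank_end_eq_integral (π : G →* V →L[ℂ] V) (hπ : Continuous π) :
    (Module.finrank ℂ ((toRep π).IntertwiningMap (toRep π)) : ℂ) =
      ∫ g, character π g * (starRingEnd ℂ) (character π g) ∂haarProb G :=
  finrank_intertwiningMap_eq_integral' π π hπ hπ

omit [TopologicalSpace G] [IsTopologicalGroup G] [MeasurableSpace G] [BorelSpace G] [CompactSpace G]
  [T2Space G] [FiniteDimensional ℂ V] in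
/-- The identity is a non-zero intertwiner of a non-zero representation: `End_G(π) ≠ 0`. -/
theorem nontrivial_end [Nontrivial V] (π : G →* V →L[ℂ] V) :
    Nontrivial ((toRep π).IntertwiningMap (toRep π)) := by
  obtain ⟨v, hv⟩ := exists_ne (0 : V)
  refine ⟨⟨Representation.IntertwiningMap.id (toRep π), 0, fun h => hv ?_⟩⟩
  have := congrArg (fun f : (toRep π).IntertwiningMap (toRep π) => f v) h
  simpa using this

omit [TopologicalSpace G] [IsTopologicalGroup G] [MeasurableSpace G] [BorelSpace G] [CompactSpace G]
  [T2Space G] in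
/-- `dim End_G(π) ≥ 1` for a non-zero `π`. -/
theorem one_le_finrank_end [Nontrivial V] (π : G →* V →L[ℂ] V) :
    1 ≤ Module.finrank ℂ ((toRep π).IntertwiningMap (toRep π)) :=
  Module.finrank_pos_iff.2 (nontrivial_end π)

/-- A reducible non-zero continuous representation has `dim End_G(π) ≥ 2`: through the splitting
`V = U ⊕ C` into non-zero stable subspaces, `End_G(π)` contains `End_G(π|U) × End_G(π|C)`. -/
theorem two_le_finrank_end_of_not_isIrreducible [Nontrivial V] (π : G →* V →L[ℂ] V)
    (hπ : Continuous π) (h : ¬ IsIrreducible π) :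
    2 ≤ Module.finrank ℂ ((toRep π).IntertwiningMap (toRep π)) := by
  simp only [T5SchurOrthogonality.IsIrreducible, not_forall, not_or] at h
  obtain ⟨U, hU, hUbot, hUtop⟩ := h
  have hUst : IsStable π U := hU
  obtain ⟨C, hC, hUC⟩ := T5AveragedProjection.exists_isCompl_isStable_of_compact π hπ hUst
  have hCbot : C ≠ ⊥ := by
    rintro rfl
    exact hUtop (by simpa using hUC.sup_eq_top)
  haveI : Nontrivial U := Submodule.nontrivial_iff_ne_bot.2 hUbot
  haveI : Nontrivial C := Submodule.nontrivial_iff_ne_bot.2 hCbot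
  -- End(π) ≃ Hom(π|U × π|C, π) ≃ Hom(π|U, π) × Hom(π|C, π)
  rw [LinearEquiv.finrank_eq (homEquivOfEquivLeft (equivProdOfIsCompl π hUst hC hUC) (toRep π)),
    LinearEquiv.finrank_eq (homProdEquivLeft _ _ (toRep π)), Module.finrank_prod]
  -- Hom(π|U, π) ≃ Hom(π|U, π|U × π|C) ≃ Hom(π|U, π|U) × Hom(π|U, π|C), and similarly for C
  have h1 : 1 ≤ Module.finrank ℂ ((toRep (restrictRep π U hUst)).IntertwiningMap (toRep π)) := by
    rw [← LinearEquiv.finrank_eq (homEquivOfEquiv _ (equivProdOfIsCompl π hUst hC hUC)),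
      LinearEquiv.finrank_eq (homProdEquiv _ _ _), Module.finrank_prod]
    exact le_add_right (one_le_finrank_end (restrictRep π U hUst))
  have h2 : 1 ≤ Module.finrank ℂ ((toRep (restrictRep π C hC)).IntertwiningMap (toRep π)) := by
    rw [← LinearEquiv.finrank_eq (homEquivOfEquiv _ (equivProdOfIsCompl π hUst hC hUC)),
      LinearEquiv.finrank_eq (homProdEquiv _ _ _), Module.finrank_prod]
    exact le_add_left (one_le_finrank_end (restrictRep π C hC))
  omega

/-- **Irreducibility criterion (Schur)**: a non-zero continuous finite-dimensional `π` is irreducible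
iff `dim End_G(π) = 1`. -/
theorem isIrreducible_iff_finrank_end_eq_one [Nontrivial V] (π : G →* V →L[ℂ] V)
    (hπ : Continuous π) :
    IsIrreducible π ↔ Module.finrank ℂ ((toRep π).IntertwiningMap (toRep π)) = 1 := by
  constructor
  · intro h
    haveI : (toRep π).IsIrreducible := (isIrreducible_iff π).1 h
    exact Representation.IsIrreducible.finrank_intertwiningMap_self (toRep π)
  · intro h
    by_contra hirr
    have := two_le_finrank_end_of_not_isIrreducible π hπ hirr
    omega

/-- **Irreducibility criterion (characters)**: a non-zero continuous finite-dimensional `π` of a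
compact Hausdorff group is irreducible iff `∫ |χ_π|² = 1`. -/
theorem isIrreducible_iff_integral_norm_sq_eq_one [Nontrivial V] (π : G →* V →L[ℂ] V)
    (hπ : Continuous π) :
    IsIrreducible π ↔
      ∫ g, character π g * (starRingEnd ℂ) (character π g) ∂haarProb G = 1 := by
  rw [isIrreducible_iff_finrank_end_eq_one π hπ, ← finrank_end_eq_integral π hπ, Nat.cast_eq_one]

open scoped Classical in
/-- **The bilinear multiplicity pairing**: for irreducible internal decompositions `S` of `V` and
`S'` of `V'`, `dim Hom_G(π, π') = Σ_{W ∈ S} Σ_{W' ∈ S'} [π|W ≃ π'|W']`. -/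
theorem finrank_intertwiningMap_eq_double_sum (π : G →* V →L[ℂ] V) (π' : G →* V' →L[ℂ] V')
    (hπ : Continuous π) (hπ' : Continuous π')
    (S : Finset (Submodule ℂ V)) (hS : ∀ W ∈ S, IsIrreducibleSubspace π W)
    (hint : DirectSum.IsInternal fun W : S => (W : Submodule ℂ V))
    (S' : Finset (Submodule ℂ V')) (hS' : ∀ W ∈ S', IsIrreducibleSubspace π' W)
    (hint' : DirectSum.IsInternal fun W : S' => (W : Submodule ℂ V')) :
    Module.finrank ℂ ((toRep π).IntertwiningMap (toRep π')) =
      ∑ W : S, ∑ W' : S', if Nonempty ((toRep (restrictRep π W (hS W W.2).2.1)).Equiv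
        (toRep (restrictRep π' W' (hS' W' W'.2).2.1))) then 1 else 0 := by
  have hst : ∀ W ∈ S, IsStable π W := fun W hW => (hS W hW).2.1
  have h := finrank_intertwiningMap_eq_integral' π π' hπ hπ'
  have hfun : (fun g => character π' g * (starRingEnd ℂ) (character π g)) =
      fun g => ∑ W : S, character π' g *
        (starRingEnd ℂ) (character (restrictRep π W (hst W W.2)) g) := by
    funext g
    rw [character_eq_sum_restrict_finset π S hint hst g, map_sum, Finset.mul_sum]
  rw [hfun, integral_finsetSum] at h
  · have hterm : ∀ W : S, ∫ g, character π' g *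
        (starRingEnd ℂ) (character (restrictRep π W (hst W W.2)) g) ∂haarProb G =
        ∑ W' : S', if Nonempty ((toRep (restrictRep π W (hS W W.2).2.1)).Equiv
          (toRep (restrictRep π' W' (hS' W' W'.2).2.1))) then (1 : ℂ) else 0 := by
      intro W
      haveI : Nontrivial W := nontrivial_of_isIrreducibleSubspace π W (hS W W.2)
      exact integral_character_mul_conj_eq_sum π' hπ' (restrictRep π W (hst W W.2))
        (continuous_restrictRep π hπ W _) (isIrreducible_restrictRep π W (hS W W.2) _) S' hS' hint'
    simp only [hterm] at h
    exact_mod_cast h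
  · intro W _
    exact T5CharacterTheory.integrable_character_mul_conj (haarProb G) π' _ hπ'
      (continuous_restrictRep π hπ W _)

end Main

end Summit.Ventures.HodgeRepro2.T5IntertwinerFormula
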